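import Mathlib
import HarnessLib

/-!
# `ArmDressing.EvenPatternDecoupling` — stub `stub_uniqueOfBallAndMixing` (PROVED)
(route `ArmDressing`, crux item stmt-CriticalPhenomena-16133, line `registered`)

An abstract bookkeeping lemma of the even-pattern decoupling for critical FK-Ising on `ℤ³`
(nothing model-specific is used). `μ L` are finite measures (finite-volume laws), `A δ z L` the
"point arms from `z^δ`", `B δ b s L` the "ball arms from the inner family `(b, s)`", `Uni δ z₀ t L`
the event "the crossing clusters of the reading balls `(z₀, t)` are unique", and `Far δ z₀ t L E`
the predicate "`E` is determined by edges outside the reading balls"; `Uniᶜ` is far.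

Hypotheses: BALL-CONDITIONED UNIQUENESS (the uniqueness defect is at most `ε ×` the ball-arm
probability, for inner families inside `B(z₀_j, η₀)`) and Kesten TV MIXING (the conditional
probabilities of a far event given the point arms and given the ball arms are `ε`-close, locally
uniformly in the point `z`). Conclusion: the uniqueness defect is at most `ε ×` the arm
probability under BOTH conditionings, locally uniformly in `z ∈ V`.

Proof: take the threshold `t₀` of the ball hypothesis at `ε / 2`; given the reading radii `t`, get
`η₁` from the ball hypothesis and `(V₂, η₂)` from mixing at `ε / 2` with the far event `Uniᶜ`;
answer `V := V₂ ∩ ∏ B(z₀_j, η₁ / 4)` and `η₀ := min η₂ (η₁ / 4)`. An inner family `(b, s)` with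
`s j < η₀` either lies inside `∏ B(z₀_j, η₁)` (main case: the ball clause is the ball hypothesis,
and the point clause follows from `μ(Uniᶜ ∩ A)/μ(A) ≤ ε/2 + μ(Uniᶜ ∩ B)/μ(B) ≤ ε`) or contains
no point `z ∈ V` with `z j ∈ B(b j, s j / 2)` (vacuous case, triangle inequality).

Mathlib only; no definitions, no named facts, no `sorry`.
-/

namespace Summit.CriticalPhenomena.Ising3DConformalLimit.Theorems.EvenPatternDecoupling

open Filter Set Metric

/-- UNIQUENESS UNDER BOTH CONDITIONINGS FROM BALL-CONDITIONED UNIQUENESS AND TV MIXING (abstract,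
proved). If the uniqueness defect of the reading-scale crossing clusters is small relative to the
ball-arm probability (for fine inner families near `z₀`), and far events have `ε`-close conditional
probabilities given point arms and given ball arms (Kesten mixing, with `Uniᶜ` far), then the
uniqueness defect is small relative to the arm probability under both the point-arm and the
ball-arm conditioning, locally uniformly in the point `z` near `z₀`. -/
theorem stub_uniqueOfBallAndMixing : open Filter Topology in ∀ {ι X : Type} [Fintype ι] [PseudoMetricSpace X] {Ω : ℕ→Type} [∀ L, MeasurableSpace (Ω L)] (μ : ∀ L, MeasureTheory.Measure (Ω L)), (∀ L, MeasureTheory.IsFiniteMeasure (μ L))→∀ (c : ι→X) (r : ι→ℝ) (A : ℝ→(ι→X)→∀ L, Set (Ω L)) (B Uni : ℝ→(ι→X)→(ι→ℝ)→∀ L, Set (Ω L)) (Far : ℝ→(ι→X)→(ι→ℝ)→∀ L, Set (Ω L)→Prop), (∀ δ b' t L, Far δ b' t L (Uni δ b' t L)ᶜ)→(∀ z₀ : ι→X, (∀ j, z₀ j ∈ Metric.ball (c j) (r j))→∀ ε : ℝ, 0 < ε→∃ t₀ : ℝ, 0 < t₀ ∧ ∀ t : ι→ℝ, (∀ j, 0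 < t j ∧ t j < t₀)→(∀ j, Metric.closedBall (z₀ j) (t j) ⊆ Metric.ball (c j) (r j))→∃ η₀ : ℝ, 0 < η₀ ∧ ∀ (b : ι→X) (s : ι→ℝ), (∀ j, 0 < s j)→(∀ j, Metric.closedBall (b j) (s j) ⊆ Metric.ball (z₀ j) η₀)→(∀ j, Metric.closedBall (b j) (s j) ⊆ Metric.ball (z₀ j) (t j / 2))→∀ᶠ δ in 𝓝[>] 0, ∀ᶠ L in atTop, (μ L).real (B δ b s L ∩ (Uni δ z₀ t L)ᶜ) ≤ ε * (μ L).real (B δ b s L))→(∀ z₀ : ι→X, (∀ j, z₀ j ∈ Metric.ball (c j) (r j))→∀ t : ι→ℝ, (∀ j, 0 < t j)→(∀ j, Metric.closedBall (z₀ j) (t j) ⊆ Metric.ball (c j) (r j))→∀ ε : ℝ, 0 < ε→∃ V ∈ 𝓝 z₀, ∃ η₀ : ℝ, 0 < η₀ ∧ ∀ (b : ι→X) (s : ι→ℝ), (∀ j, 0 < s j ∧ s j < η₀)→(∀ j, Metric.closedBall (b j) (s j) ⊆ Metric.ball (z₀ j) (t j / 2))→∀ᶠ δ in 𝓝[>]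 0, ∀ z ∈ V, (∀ j, z j ∈ Metric.ball (b j) (s j / 2))→∀ Eν : ∀ L, Set (Ω L), (∀ L, Far δ z₀ t L (Eν L))→∀ᶠ L in atTop, |(μ L).real (Eν L ∩ A δ z L) / (μ L).real (A δ z L) - (μ L).real (Eν L ∩ B δ b s L) / (μ L).real (B δ b s L)| ≤ ε)→∀ z₀ : ι→X, (∀ j, z₀ j ∈ Metric.ball (c j) (r j))→∀ ε : ℝ, 0 < ε→∃ t₀ : ℝ, 0 < t₀ ∧ ∀ t : ι→ℝ, (∀ j, 0 < t j ∧ t j < t₀)→(∀ j, Metric.closedBall (z₀ j) (t j) ⊆ Metric.ball (c j) (r j))→∃ V ∈ 𝓝 z₀, ∃ η₀ : ℝ, 0 < η₀ ∧ ∀ (b : ι→X) (s : ι→ℝ), (∀ j, 0 < s j ∧ s j < η₀)→(∀ j, Metric.closedBall (b j) (s j) ⊆ Metric.ball (z₀ j) (t j / 2))→∀ᶠ δ in 𝓝[>] 0, ∀ z ∈ V, (∀ j, z j ∈ Metric.ball (b j) (s j / 2))→∀ᶠ L in atTop, (μ L).real (A δ z L ∩ (Uni δ z₀ t L)ᶜ)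 ≤ ε * (μ L).real (A δ z L) ∧ (μ L).real (B δ b s L ∩ (Uni δ z₀ t L)ᶜ) ≤ ε * (μ L).real (B δ b s L) := by
  intro ι X _ _ Ω _ μ hfin c r A B Uni Far hfarU hball hmix z₀ hz₀ ε hε
  have hε2 : 0 < ε / 2 := by positivity
  -- the threshold of the ball hypothesis at `ε / 2`
  obtain ⟨t₀, ht₀, HB0⟩ := hball z₀ hz₀ (ε / 2) hε2
  refine ⟨t₀, ht₀, fun t ht htadm => ?_⟩
  obtain ⟨η₁, hη₁, HB⟩ := HB0 t ht htadm
  obtain ⟨V₂, hV₂, η₂, hη₂, HM⟩ := hmix z₀ hz₀ t (fun j => (ht j).1) htadm (ε / 2) hε2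
  -- the neighbourhood and the fineness threshold
  have hopen : IsOpen {z : ι → X | ∀ j, z j ∈ ball (z₀ j) (η₁ / 4)} := by
    have hEq : {z : ι → X | ∀ j, z j ∈ ball (z₀ j) (η₁ / 4)} =
        ⋂ j, (fun z : ι → X => z j) ⁻¹' ball (z₀ j) (η₁ / 4) := by
      ext z; simp
    rw [hEq]
    exact isOpen_iInter_of_finite fun j => isOpen_ball.preimage (continuous_apply j)
  have hself : ∀ j, z₀ j ∈ ball (z₀ j) (η₁ / 4) := fun j => mem_ball_self (by positivity)
  refine ⟨V₂ ∩ {z | ∀ j, z j ∈ ball (z₀ j) (η₁ / 4)}, inter_mem hV₂ (hopen.mem_nhds hself),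
    min η₂ (η₁ / 4), lt_min hη₂ (by positivity), fun b s hs hbs => ?_⟩
  have hs₂ : ∀ j, 0 < s j ∧ s j < η₂ := fun j =>
    ⟨(hs j).1, lt_of_lt_of_le (hs j).2 (min_le_left _ _)⟩
  have hs₄ : ∀ j, s j < η₁ / 4 := fun j => lt_of_lt_of_le (hs j).2 (min_le_right _ _)
  by_cases hin : ∀ j, closedBall (b j) (s j) ⊆ ball (z₀ j) η₁
  · -- MAIN CASE: the inner family lies inside `∏ B(z₀_j, η₁)`
    filter_upwards [HB b s (fun j => (hs j).1) hin hbs, HM b s hs₂ hbs] with δ hBδ hMδ z hz hzin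
    filter_upwards [hBδ, hMδ z hz.1 hzin (fun L => (Uni δ z₀ t L)ᶜ) fun L => hfarU δ z₀ t L]
      with L hBL hML
    haveI := hfin L
    have hBnn : 0 ≤ (μ L).real (B δ b s L) := MeasureTheory.measureReal_nonneg
    have hAnn : 0 ≤ (μ L).real (A δ z L) := MeasureTheory.measureReal_nonneg
    refine ⟨?_, hBL.trans (mul_le_mul_of_nonneg_right (by linarith) hBnn)⟩
    -- the point clause
    by_cases ha : (μ L).real (A δ z L) = 0
    · have h1 : (μ L).real (A δ z L ∩ (Uni δ z₀ t L)ᶜ) ≤ (μ L).real (A δ z L) :=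
        MeasureTheory.measureReal_mono Set.inter_subset_left
      rw [ha, mul_zero]
      linarith
    · have ha_pos : 0 < (μ L).real (A δ z L) := lt_of_le_of_ne hAnn (Ne.symm ha)
      have hq : (μ L).real ((Uni δ z₀ t L)ᶜ ∩ B δ b s L) / (μ L).real (B δ b s L) ≤ ε / 2 := by
        by_cases hb : (μ L).real (B δ b s L) = 0
        · rw [hb, div_zero]; exact hε2.le
        · have hb_pos : 0 < (μ L).real (B δ b s L) := lt_of_le_of_ne hBnn (Ne.symm hb)
          rw [div_le_iff₀ hb_pos, Set.inter_comm]
          exact hBL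
      have hML' := (abs_sub_le_iff.1 hML).1
      have h3 : (μ L).real ((Uni δ z₀ t L)ᶜ ∩ A δ z L) / (μ L).real (A δ z L) ≤ ε := by
        linarith
      rw [div_le_iff₀ ha_pos] at h3
      rw [Set.inter_comm]
      exact h3
  · -- VACUOUS CASE: no point of the neighbourhood lies well inside this inner family
    refine Filter.Eventually.of_forall fun δ z hz hzin => (hin fun j x hx => ?_).elim
    rw [mem_closedBall] at hx
    have h1 := mem_ball.1 (hzin j)
    have h2 := mem_ball.1 (hz.2 j)
    have h3 := hs₄ j
    have h4 := (hs j).1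
    rw [mem_ball]
    calc dist x (z₀ j) ≤ dist x (b j) + dist (b j) (z j) + dist (z j) (z₀ j) := dist_triangle4 _ _ _ _
      _ < η₁ := by rw [dist_comm (b j) (z j)]; linarith

end Summit.CriticalPhenomena.Ising3DConformalLimit.Theorems.EvenPatternDecoupling
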